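import Mathlib
import Summits.Ventures.HodgeRepro2.T5HeckeDoubleCoset
import Summits.Ventures.HodgeRepro2.T5HeckeCorner

/-!
# Haar measure and double cosets: `vol(KgK) = #(KgK/K) · vol(K)`

The Hecke-algebra bookkeeping of `T5HeckeDoubleCoset` / `T5HeckeConvolution` is Haar-free: it
counts cosets.  This file connects the counts to Mathlib's Haar measure.  For a left Haar measure
`μ` on a topological group `G` (`MeasureTheory.Measure.IsHaarMeasure`) and a measurable subgroup
`K`:

* `measure_preimage_mk`: the preimage in `G` of a FINITE set `O` of left cosets has measure
  `#O · μ(K)` — each fibre `xK` is a left translate of `K`, the fibres are disjoint;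
* `measure_doubleCosetSet`: THE VOLUME OF A DOUBLE COSET `μ(KgK) = #(KgK/K) · μ(K)`, and for
  `K` compact open `0 < μ(K) < ∞`, so `μ(KgK)/μ(K) = #(KgK/K)`: with the normalisation
  `vol(K) = 1` the factor `#(KgK/K)⁻¹` in `e_K π(g) e_K = #(KgK/K)⁻¹ · T_g` is `vol(K)/vol(KgK)`;
* `measure_eq_relIndex_mul`: THE INDEX FORMULA `μ(K) = [K : K'] · μ(K')` for `K' ≤ K` of finite
  index, where `[K : K'] = #(K·K'/K')` is `T5HeckeCorner.levelIndex` and Mathlib's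
  `Subgroup.relIndex K' K` — the normalisation `vol(K')/vol(K) = [K : K']⁻¹` of the level
  idempotent.
-/

namespace Summit.Ventures.HodgeRepro2.T5HaarDoubleCosetVolume

open MeasureTheory

section Group

variable {G : Type*} [Group G]

/-- The fibre of `G → G/K` over the coset `xK` is the left translate `xK = {y | x⁻¹ y ∈ K}`. -/
theorem preimage_mk_singleton (K : Subgroup G) (x : G) :
    (QuotientGroup.mk : G → G ⧸ K) ⁻¹' {(x : G ⧸ K)} = (fun y => x⁻¹ * y) ⁻¹' (K : Set G) := by
  ext y
  simp only [Set.mem_preimage, Set.mem_singleton_iff, SetLike.mem_coe]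
  rw [eq_comm, QuotientGroup.eq]

/-- The fibres of `G → G/K` over distinct cosets are disjoint. -/
theorem pairwiseDisjoint_preimage_mk_singleton (K : Subgroup G) (s : Set (G ⧸ K)) :
    s.PairwiseDisjoint fun q => (QuotientGroup.mk : G → G ⧸ K) ⁻¹' {q} := by
  intro x _ y _ hxy
  rw [Function.onFun, Set.disjoint_left]
  intro a ha hb
  rw [Set.mem_preimage, Set.mem_singleton_iff] at ha hb
  exact hxy (ha.symm.trans hb)

/-- THE DOUBLE COSET `KgK` as a subset of `G`: the preimage of the `K`-orbit of `gK` in `G/K`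
(the object whose cosets `T5HeckeDoubleCoset` counts). -/
def doubleCosetSet (K : Subgroup G) (g : G) : Set G :=
  (QuotientGroup.mk : G → G ⧸ K) ⁻¹' MulAction.orbit K (g : G ⧸ K)

/-- `y ∈ KgK ↔ y = κ₁ g κ₂` with `κ₁, κ₂ ∈ K`. -/
theorem mem_doubleCosetSet_iff (K : Subgroup G) (g y : G) :
    y ∈ doubleCosetSet K g ↔ ∃ κ₁ ∈ K, ∃ κ₂ ∈ K, y = κ₁ * g * κ₂ := by
  unfold doubleCosetSet
  rw [Set.mem_preimage, MulAction.mem_orbit_iff]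
  constructor
  · rintro ⟨κ, hκ⟩
    have hκ' : (κ : G) • (g : G ⧸ K) = (y : G ⧸ K) := hκ
    rw [MulAction.Quotient.smul_mk, smul_eq_mul, QuotientGroup.eq] at hκ'
    refine ⟨κ, κ.2, ((κ : G) * g)⁻¹ * y, hκ', ?_⟩
    rw [mul_inv_cancel_left]
  · rintro ⟨κ₁, hκ₁, κ₂, hκ₂, rfl⟩
    refine ⟨⟨κ₁, hκ₁⟩, ?_⟩
    show κ₁ • (g : G ⧸ K) = _
    rw [MulAction.Quotient.smul_mk, smul_eq_mul, QuotientGroup.eq, inv_mul_cancel_left]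
    exact hκ₂

/-- The double coset `KgK` contains `g`. -/
theorem self_mem_doubleCosetSet (K : Subgroup G) (g : G) : g ∈ doubleCosetSet K g :=
  MulAction.mem_orbit_self _

/-- `K` is the preimage of the `K`-orbit of the trivial coset in `G/K'` when `K' ≤ K`
(`T5HeckeCorner.mem_orbit_one_iff`). -/
theorem preimage_mk_orbit_one {K K' : Subgroup G} (hle : K' ≤ K) :
    (QuotientGroup.mk : G → G ⧸ K') ⁻¹' MulAction.orbit K ((1 : G) : G ⧸ K') = (K : Set G) := by
  ext y
  rw [Set.mem_preimage, T5HeckeCorner.mem_orbit_one_iff, SetLike.mem_coe]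
  constructor
  · rintro ⟨κ, hκ, h⟩
    rw [QuotientGroup.eq] at h
    have : y = κ * (κ⁻¹ * y) := by rw [mul_inv_cancel_left]
    rw [this]
    exact K.mul_mem hκ (hle h)
  · intro hy
    exact ⟨y, hy, rfl⟩

/-- `#(K·K'/K') = [K : K']` (Mathlib's `Subgroup.relIndex K' K`): the `K`-orbit of the trivial
coset of `G/K'` is `K/K'` (`T5HeckeCorner.stabilizer_one_eq` + `MulAction.orbitEquivQuotientStabilizer`). -/
theorem ncard_orbit_one_eq_relIndex (K K' : Subgroup G) :
    (MulAction.orbit K ((1 : G) : G ⧸ K')).ncard = K'.relIndex K := by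
  rw [← Nat.card_coe_set_eq, Nat.card_congr (MulAction.orbitEquivQuotientStabilizer K _),
    T5HeckeCorner.stabilizer_one_eq K K', Subgroup.relIndex, Subgroup.index_eq_card]

end Group

section LeftInvariant

variable {G : Type*} [Group G] [MeasurableSpace G] [MeasurableMul G]

/-- The fibre of `G → G/K` over any coset is measurable when `K` is. -/
theorem measurableSet_preimage_mk_singleton {K : Subgroup G} (hK : MeasurableSet (K : Set G))
    (q : G ⧸ K) : MeasurableSet ((QuotientGroup.mk : G → G ⧸ K) ⁻¹' {q}) := by
  rw [← QuotientGroup.out_eq' q, preimage_mk_singleton]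
  exact hK.preimage (measurable_const_mul _)

variable (μ : Measure G) [μ.IsMulLeftInvariant]

/-- Each left coset `xK` has the measure of `K` (left invariance of the measure). -/
theorem measure_preimage_mk_singleton (K : Subgroup G) (q : G ⧸ K) :
    μ ((QuotientGroup.mk : G → G ⧸ K) ⁻¹' {q}) = μ K := by
  conv_lhs => rw [← QuotientGroup.out_eq' q]
  rw [preimage_mk_singleton, measure_preimage_mul]

/-- THE MEASURE OF A FINITE UNION OF LEFT COSETS: `μ(mk⁻¹(O)) = #O · μ(K)` for a finite set
`O ⊆ G/K` of cosets and a measurable `K`. -/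
theorem measure_preimage_mk {K : Subgroup G} (hK : MeasurableSet (K : Set G)) {O : Set (G ⧸ K)}
    (hO : O.Finite) :
    μ ((QuotientGroup.mk : G → G ⧸ K) ⁻¹' O) = (O.ncard : ENNReal) * μ K := by
  classical
  have hunion : (QuotientGroup.mk : G → G ⧸ K) ⁻¹' O =
      ⋃ q ∈ hO.toFinset, (QuotientGroup.mk : G → G ⧸ K) ⁻¹' {q} := by
    conv_lhs => rw [← Set.biUnion_of_singleton O]
    rw [Set.preimage_iUnion₂]
    ext y
    simp only [Set.mem_iUnion, Set.mem_preimage, Set.mem_singleton_iff, Set.Finite.mem_toFinset,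
      exists_prop]
  rw [hunion, measure_biUnion_finset (pairwiseDisjoint_preimage_mk_singleton K _)
    (fun q _ => measurableSet_preimage_mk_singleton hK q)]
  rw [Finset.sum_congr rfl (fun q _ => measure_preimage_mk_singleton μ K q), Finset.sum_const,
    nsmul_eq_mul, Set.ncard_eq_toFinset_card O hO]

/-- THE VOLUME OF A DOUBLE COSET: `μ(KgK) = #(KgK/K) · μ(K)` for measurable `K` and a finite
double coset (mod `K`), for any left-invariant measure. -/
theorem measure_doubleCosetSet {K : Subgroup G} (hK : MeasurableSet (K : Set G)) (g : G)
    [Finite (MulAction.orbit K (g : G ⧸ K))] :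
    μ (doubleCosetSet K g) = ((MulAction.orbit K (g : G ⧸ K)).ncard : ENNReal) * μ K :=
  measure_preimage_mk μ hK (Set.toFinite _)

end LeftInvariant

section Haar

variable {G : Type*} [Group G] [TopologicalSpace G] [IsTopologicalGroup G] [MeasurableSpace G]
  [BorelSpace G] (μ : Measure G) [μ.IsHaarMeasure]

omit [IsTopologicalGroup G] [BorelSpace G] in
/-- `K` open has positive measure. -/
theorem measure_pos_of_isOpen {K : Subgroup G} (hopen : IsOpen (K : Set G)) : 0 < μ K :=
  hopen.measure_pos μ ⟨1, K.one_mem⟩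

omit [IsTopologicalGroup G] [BorelSpace G] in
/-- `K` compact has finite measure. -/
theorem measure_ne_top_of_isCompact {K : Subgroup G} (hcpt : IsCompact (K : Set G)) : μ K ≠ ⊤ :=
  hcpt.measure_lt_top.ne

/-- THE VOLUME OF A DOUBLE COSET for `K` compact open: `μ(KgK) = #(KgK/K) · μ(K)`
(the finiteness of `KgK/K` is `T5HeckeDoubleCoset.finite_orbit_coset_of_isOpen_of_isCompact`). -/
theorem measure_doubleCosetSet_of_isOpen_of_isCompact {K : Subgroup G} (hopen : IsOpen (K : Set G))
    (hcpt : IsCompact (K : Set G)) (g : G) :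
    μ (doubleCosetSet K g) = ((MulAction.orbit K (g : G ⧸ K)).ncard : ENNReal) * μ K := by
  haveI := T5HeckeDoubleCoset.finite_orbit_coset_of_isOpen_of_isCompact K g hopen hcpt
  exact measure_doubleCosetSet μ hopen.measurableSet g

/-- `μ(KgK)/μ(K) = #(KgK/K)` for `K` compact open: the count of `T5HeckeDoubleCoset` IS the
ratio of Haar volumes, for ANY Haar measure. -/
theorem measure_doubleCosetSet_div {K : Subgroup G} (hopen : IsOpen (K : Set G))
    (hcpt : IsCompact (K : Set G)) (g : G) :
    μ (doubleCosetSet K g) / μ K = ((MulAction.orbit K (g : G ⧸ K)).ncard : ENNReal) := by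
  rw [measure_doubleCosetSet_of_isOpen_of_isCompact μ hopen hcpt g,
    ENNReal.mul_div_cancel_right (measure_pos_of_isOpen μ hopen).ne'
      (measure_ne_top_of_isCompact μ hcpt)]

/-- With the normalisation `vol(K) = 1`: `μ(KgK) = #(KgK/K)`. -/
theorem measure_doubleCosetSet_of_measure_eq_one {K : Subgroup G} (hopen : IsOpen (K : Set G))
    (hcpt : IsCompact (K : Set G)) (hμ : μ K = 1) (g : G) :
    μ (doubleCosetSet K g) = ((MulAction.orbit K (g : G ⧸ K)).ncard : ENNReal) := by
  rw [measure_doubleCosetSet_of_isOpen_of_isCompact μ hopen hcpt g, hμ, mul_one]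

/-- The normalising factor of `T5HeckeDoubleCoset.heckeOp_eq_inv_ncard_smul`
(`e_K π(g) e_K = #(KgK/K)⁻¹ · T_g`) as a ratio of Haar volumes: `#(KgK/K)⁻¹ = μ(K)/μ(KgK)`
(real numbers; `K` compact open). -/
theorem inv_ncard_eq_measure_div {K : Subgroup G} (hopen : IsOpen (K : Set G))
    (hcpt : IsCompact (K : Set G)) (g : G) :
    (((MulAction.orbit K (g : G ⧸ K)).ncard : ℝ))⁻¹ =
      (μ K).toReal / (μ (doubleCosetSet K g)).toReal := by
  rw [measure_doubleCosetSet_of_isOpen_of_isCompact μ hopen hcpt g, ENNReal.toReal_mul,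
    ENNReal.toReal_natCast]
  have hpos : (μ K).toReal ≠ 0 :=
    (ENNReal.toReal_pos (measure_pos_of_isOpen μ hopen).ne'
      (measure_ne_top_of_isCompact μ hcpt)).ne'
  have hn : ((MulAction.orbit K (g : G ⧸ K)).ncard : ℝ) ≠ 0 := by
    haveI := T5HeckeDoubleCoset.finite_orbit_coset_of_isOpen_of_isCompact K g hopen hcpt
    exact_mod_cast (Set.ncard_pos (Set.toFinite _)).2 ⟨_, MulAction.mem_orbit_self _⟩ |>.ne'
  field_simp

/-- THE INDEX FORMULA: `μ(K) = [K : K'] · μ(K')` for `K' ≤ K` of finite index, with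
`[K : K'] = #(K·K'/K')` (the `ncard` of `T5HeckeCorner.levelIndex`). -/
theorem measure_eq_ncard_orbit_one_mul {K K' : Subgroup G} (hle : K' ≤ K)
    (hK' : MeasurableSet (K' : Set G)) [Finite (MulAction.orbit K ((1 : G) : G ⧸ K'))] :
    μ K = ((MulAction.orbit K ((1 : G) : G ⧸ K')).ncard : ENNReal) * μ K' := by
  rw [← preimage_mk_orbit_one hle, measure_preimage_mk μ hK' (Set.toFinite _)]

/-- THE INDEX FORMULA with Mathlib's index: `μ(K) = (K'.relIndex K) · μ(K')` for `K' ≤ K` of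
finite index (`K'` measurable). -/
theorem measure_eq_relIndex_mul {K K' : Subgroup G} (hle : K' ≤ K)
    (hK' : MeasurableSet (K' : Set G)) [Finite (MulAction.orbit K ((1 : G) : G ⧸ K'))] :
    μ K = (K'.relIndex K : ENNReal) * μ K' := by
  rw [measure_eq_ncard_orbit_one_mul μ hle hK', ncard_orbit_one_eq_relIndex]

/-- The normalisation of the level idempotent: `vol(K')/vol(K) = [K : K']⁻¹` for an open subgroup
`K'` of finite index in a compact subgroup `K` (real numbers). -/
theorem measure_div_eq_inv_relIndex {K K' : Subgroup G} (hle : K' ≤ K)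
    (hcpt : IsCompact (K : Set G)) (hopen' : IsOpen (K' : Set G))
    [Finite (MulAction.orbit K ((1 : G) : G ⧸ K'))] :
    (μ K').toReal / (μ K).toReal = ((K'.relIndex K : ℝ))⁻¹ := by
  have hcpt' : IsCompact (K' : Set G) :=
    hcpt.of_isClosed_subset (K'.isClosed_of_isOpen hopen') (SetLike.coe_subset_coe.2 hle)
  rw [measure_eq_relIndex_mul μ hle hopen'.measurableSet, ENNReal.toReal_mul, ENNReal.toReal_natCast]
  have hpos : (μ K').toReal ≠ 0 :=
    (ENNReal.toReal_pos (measure_pos_of_isOpen μ hopen').ne'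
      (measure_ne_top_of_isCompact μ hcpt')).ne'
  have hn : ((K'.relIndex K : ℕ) : ℝ) ≠ 0 := by
    rw [← ncard_orbit_one_eq_relIndex]
    exact_mod_cast (Set.ncard_pos (Set.toFinite _)).2 ⟨_, MulAction.mem_orbit_self _⟩ |>.ne'
  field_simp

end Haar

end Summit.Ventures.HodgeRepro2.T5HaarDoubleCosetVolume
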